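import Literature.NumberTheory.EllipticCurves.KubertTate1314Kummer
import HarnessLib

/-!
# `rank E_{13/14}(ℚ) ≥ 2` by `5`-descent: the Kubert–Tate curve `[1, -182, -2548, 0, 0]`

PROOF-ONLY file (theorems only), topic `NumberTheory/EllipticCurves`; sequel of
`KubertTate1314Torsion` and `KubertTate1314Kummer`. For

  `E = E_{13/14} = kubertTateFive 13 14 : y² + xy - 2548 y = x³ - 182 x²`

(`Δ = -2⁵·7⁵·13⁵·2029`, `T = (0,0)` of order `5`, `E(ℚ)[5] = ⟨T⟩`) we prove, unconditionally and
without any `L`-function or local (completion) input: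

* (from `KubertTate1314Kummer`) `exists_pow_five_mul_eq` — a relation `aX₁ + bX₂ + cX₃ = 5Q` among
  rational points `∉ {O, T}` gives `f_T(X₁)^a f_T(X₂)^b f_T(X₃)^c ∈ f_T(5Q₀)^{a+b+c}·(ℚˣ)⁵`
  (`f_T = xy - 14x² + 196y`, Kummer elements and the Weil pairing);
* `indep` — the classes of `T₂ = 2T = (182, 2366)`, `P₁ = (-78, 936)`, `P₂ = (98, 392)` in
  `E(ℚ)/5E(ℚ)` are **independent over `𝔽₅`**: the relation `T₂ + (-T₂) = O` with
  `f_T(2T) f_T(3T) = -182⁵` removes `f_T(5Q₀)`, and the `2`-, `7`-, `13`-adic valuations of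
  `f_T(2T) = 2²7²13³`, `f_T(P₁) = 2³3⁵13`, `f_T(P₂) = -2³7⁴` (a matrix of determinant `≢ 0 mod 5`)
  force `5 ∣ i, j, k`;
* `card_quotient_ge` — hence **`#E(ℚ)/5E(ℚ) ≥ 125`**, and with `#E(ℚ)/5E(ℚ) = 5^{rank} · #E(ℚ)[5]`
  (Mordell–Weil and the structure theorem, tree `natCard_quotient_nsmulRange_eq`) and `#E(ℚ)[5] = 5`:
* `two_le_mordellWeilRank` — **`rank E_{13/14}(ℚ) ≥ 2`.**

(The reverse inequality `rank ≤ 2` would follow from the `ℤ/5`-side `Sel^φ = 0` of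
`KubertTateFiveSelmerTame` plus the valuations of `f_T` at ALL rational points; `Ш(E/ℚ)[5] = 0`
needs local conditions at `5` and `2029` and is not claimed.)

## References

* [SilvermanAEC2009] J. H. Silverman, *AEC*, 2nd ed., III.§8, X.1.1, X.4, Exercise 10.1.
* [Fisher2001FiveSevenDescent] T. Fisher, *Some examples of 5 and 7 descent for elliptic curves over
  ℚ*, JEMS 3 (2001), §1 (the method on the family `D_λ` of curves with a rational `5`-torsion point;
  `E_{13/14}` is the member `λ = 13/14`, not treated there; the points `P₁`, `P₂` are ours).
* [Kubert1976] D. S. Kubert, *Universal bounds on the torsion of elliptic curves*, Table 3.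
-/

noncomputable section

open scoped Classical
open WeierstrassCurve Field
open Literature.NumberTheory.EllipticCurves Literature.NumberTheory.EllipticCurves.KubertTateKummer
  Literature.NumberTheory.EllipticCurves.KubertTateVelu

-- The `ℚ`-algebra diamond on `AlgebraicClosure ℚ` (`DivisionRing.toRatAlgebra` vs
-- `AlgebraicClosure.instAlgebra`): the tree's Kummer theory is keyed on the latter (same device as
-- `X1ElevenMordellWeil` and `KubertTate1314Torsion`).
attribute [-instance] DivisionRing.toRatAlgebra

namespace Literature.NumberTheory.EllipticCurves

namespace KubertTate1314Descent

/-! ## Part C. Values of `f_T`, independence in `E(ℚ)/5E(ℚ)`, and the rank -/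

/-- `f_T(x, y) = xy - 14x² + 196y` at a rational point, as a value of the tree's `kummerFn 13 14`.
[cite: SilvermanAEC2009, Exercise 10.1(c)] -/
theorem hasValueAt_point {x y : ℚ} (h : E.toAffine.Nonsingular x y) :
    E.HasValueAt (kummerFn (13 : ℚ) 14) (toGeom (.some x y h))
      (algebraMap ℚ (AlgebraicClosure ℚ) (x * y - 14 * x ^ 2 + 14 ^ 2 * y)) := by
  obtain ⟨h', e⟩ := toGeom_some h
  rw [e]
  refine (hasValueAt_kummerFn (13 : ℚ) 14 h').congr rfl ?_
  simp only [map_sub, map_add, map_mul, map_pow]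

/-- An affine rational point with `x ≠ 0` is neither `O` nor `T`. [folklore] -/
private theorem some_ne {x y : ℚ} (h : E.toAffine.Nonsingular x y) (hx : x ≠ 0) :
    (Affine.Point.some x y h : E.toAffine.Point) ≠ 0 ∧ Affine.Point.some x y h ≠ T :=
  ⟨Affine.Point.some_ne_zero _, fun e ↦ hx (by injection e)⟩

/-- `v_p(n) = k` from a factorisation `n = p^k · r`, `p ∤ r`. [folklore] -/
private theorem padicValRat_natCast_eq {p n k r : ℕ} [hp : Fact p.Prime] (h : n = p ^ k * r)
    (hr : ¬ p ∣ r) : padicValRat p (n : ℚ) = k := by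
  have hr0 : r ≠ 0 := fun h0 ↦ hr (h0 ▸ dvd_zero p)
  rw [padicValRat.of_nat, h, padicValNat.mul (pow_ne_zero _ hp.out.ne_zero) hr0, padicValNat.prime_pow,
    padicValNat.eq_zero_of_not_dvd hr, add_zero]

/-- The `2`-, `7`-, `13`-adic valuations of `f_T(2T) = 430612 = 2²7²13³`, `f_T(P₁) = 25272 = 2³3⁵13`,
`f_T(P₂) = -19208 = -2³7⁴`, `f_T(3T) = -463736 = -2³7³13²` (arithmetic). [folklore] -/
private theorem vals :
    (padicValRat 2 (430612 : ℚ) = 2 ∧ padicValRat 2 (25272 : ℚ) = 3 ∧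
      padicValRat 2 (-19208 : ℚ) = 3 ∧ padicValRat 2 (-463736 : ℚ) = 3) ∧
    (padicValRat 7 (430612 : ℚ) = 2 ∧ padicValRat 7 (25272 : ℚ) = 0 ∧
      padicValRat 7 (-19208 : ℚ) = 4 ∧ padicValRat 7 (-463736 : ℚ) = 3) ∧
    (padicValRat 13 (430612 : ℚ) = 3 ∧ padicValRat 13 (25272 : ℚ) = 1 ∧
      padicValRat 13 (-19208 : ℚ) = 0 ∧ padicValRat 13 (-463736 : ℚ) = 2) := by
  haveI : Fact (Nat.Prime 2) := ⟨Nat.prime_two⟩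
  haveI : Fact (Nat.Prime 7) := ⟨by norm_num⟩
  haveI : Fact (Nat.Prime 13) := ⟨by norm_num⟩
  refine ⟨⟨?_, ?_, ?_, ?_⟩, ⟨?_, ?_, ?_, ?_⟩, ⟨?_, ?_, ?_, ?_⟩⟩
  · exact_mod_cast padicValRat_natCast_eq (p := 2) (n := 430612) (k := 2) (r := 107653) (by norm_num) (by norm_num)
  · exact_mod_cast padicValRat_natCast_eq (p := 2) (n := 25272) (k := 3) (r := 3159) (by norm_num) (by norm_num)
  · rw [padicValRat.neg]
    exact_mod_cast padicValRat_natCast_eq (p := 2) (n := 19208) (k := 3) (r := 2401) (by norm_num) (by norm_num)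
  · rw [padicValRat.neg]
    exact_mod_cast padicValRat_natCast_eq (p := 2) (n := 463736) (k := 3) (r := 57967) (by norm_num) (by norm_num)
  · exact_mod_cast padicValRat_natCast_eq (p := 7) (n := 430612) (k := 2) (r := 8788) (by norm_num) (by norm_num)
  · exact_mod_cast padicValRat_natCast_eq (p := 7) (n := 25272) (k := 0) (r := 25272) (by norm_num) (by norm_num)
  · rw [padicValRat.neg]
    exact_mod_cast padicValRat_natCast_eq (p := 7) (n := 19208) (k := 4) (r := 8) (by norm_num) (by norm_num)
  · rw [padicValRat.neg]
    exact_mod_cast padicValRat_natCast_eq (p := 7) (n := 463736) (k := 3) (r := 1352) (by norm_num) (by norm_num)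
  · exact_mod_cast padicValRat_natCast_eq (p := 13) (n := 430612) (k := 3) (r := 196) (by norm_num) (by norm_num)
  · exact_mod_cast padicValRat_natCast_eq (p := 13) (n := 25272) (k := 1) (r := 1944) (by norm_num) (by norm_num)
  · rw [padicValRat.neg]
    exact_mod_cast padicValRat_natCast_eq (p := 13) (n := 19208) (k := 0) (r := 19208) (by norm_num) (by norm_num)
  · rw [padicValRat.neg]
    exact_mod_cast padicValRat_natCast_eq (p := 13) (n := 463736) (k := 2) (r := 2744) (by norm_num) (by norm_num)

/-- From `Φ² u₁^{5s} = u^{10} Ψ^s` in `ℚˣ`: `5 ∣ 2 v_p(Φ) - s v_p(Ψ)`. [folklore] -/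
private theorem five_dvd_of_rel {p : ℕ} [Fact p.Prime] {Φ Ψ u u₁ : ℚ} (hΦ : Φ ≠ 0) (hΨ : Ψ ≠ 0)
    (hu : u ≠ 0) (hu₁ : u₁ ≠ 0) {s : ℕ} (h : Φ ^ 2 * u₁ ^ (5 * s) = u ^ 10 * Ψ ^ s) :
    (5 : ℤ) ∣ 2 * padicValRat p Φ - s * padicValRat p Ψ := by
  have e := congrArg (padicValRat p) h
  rw [padicValRat.mul (pow_ne_zero _ hΦ) (pow_ne_zero _ hu₁),
    padicValRat.mul (pow_ne_zero _ hu) (pow_ne_zero _ hΨ), padicValRat.pow Φ, padicValRat.pow u₁,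
    padicValRat.pow u, padicValRat.pow Ψ] at e
  push_cast at e
  exact ⟨2 * padicValRat p u - s * padicValRat p u₁, by linear_combination e⟩

/-- `v_p(f₀^i f₁^j f₂^k) = i v_p(f₀) + j v_p(f₁) + k v_p(f₂)`. [folklore] -/
private theorem padicValRat_prod_pow (p : ℕ) [Fact p.Prime] {f₀ f₁ f₂ : ℚ} (h₀ : f₀ ≠ 0)
    (h₁ : f₁ ≠ 0) (h₂ : f₂ ≠ 0) (i j k : ℕ) :
    padicValRat p (f₀ ^ i * f₁ ^ j * f₂ ^ k) =
      i * padicValRat p f₀ + j * padicValRat p f₁ + k * padicValRat p f₂ := by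
  rw [padicValRat.mul (mul_ne_zero (pow_ne_zero _ h₀) (pow_ne_zero _ h₁)) (pow_ne_zero _ h₂),
    padicValRat.mul (pow_ne_zero _ h₀) (pow_ne_zero _ h₁), padicValRat.pow f₀, padicValRat.pow f₁,
    padicValRat.pow f₂]

/-- **Independence of `2T`, `P₁`, `P₂` in `E(ℚ)/5E(ℚ)`**: if `i·T₂ + j·P₁ + k·P₂ ∈ 5E(ℚ)` then
`5 ∣ i`, `5 ∣ j`, `5 ∣ k` (the Kummer images `(2,2,3)`, `(3,0,1)`, `(3,4,0)` of `f_T(2T)`, `f_T(P₁)`,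
`f_T(P₂)` in `⟨2, 7, 13⟩ ⊗ 𝔽₅` are independent; `f_T(5Q₀)` is eliminated by the relation
`T₂ + (-T₂) = O`, `f_T(2T) f_T(3T) = -182⁵`). [cite: SilvermanAEC2009, Thm. X.1.1 and Exercise 10.1 (the method; the curve and points are ours)] -/
theorem indep {i j k : ℕ} {Q : E.toAffine.Point} (hrel : i • T₂ + j • P₁ + k • P₂ = (5 : ℕ) • Q) :
    5 ∣ i ∧ 5 ∣ j ∧ 5 ∣ k := by
  set ι := algebraMap ℚ (AlgebraicClosure ℚ) with hι
  have hnsT₂ : E.toAffine.Nonsingular 182 2366 := (nonsingular_iff _ _).mpr (by norm_num)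
  have hnsT₃ : E.toAffine.Nonsingular 182 0 := (nonsingular_iff _ _).mpr (by norm_num)
  have hnsP₁ : E.toAffine.Nonsingular (-78) 936 := (nonsingular_iff _ _).mpr (by norm_num)
  have hnsP₂ : E.toAffine.Nonsingular 98 392 := (nonsingular_iff _ _).mpr (by norm_num)
  -- the points are `∉ {O, T}`
  obtain ⟨hT₂0, hT₂T⟩ := some_ne hnsT₂ (by norm_num)
  obtain ⟨hT₃0, hT₃T⟩ := some_ne hnsT₃ (by norm_num)
  obtain ⟨hP₁0, hP₁T⟩ := some_ne hnsP₁ (by norm_num)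
  obtain ⟨hP₂0, hP₂T⟩ := some_ne hnsP₂ (by norm_num)
  -- values of `f_T`
  have hfT₂ : E.HasValueAt (kummerFn (13 : ℚ) 14) (toGeom T₂) (ι 430612) :=
    (hasValueAt_point hnsT₂).congr rfl (by norm_num)
  have hfT₃ : E.HasValueAt (kummerFn (13 : ℚ) 14) (toGeom (.some 182 0 hnsT₃)) (ι (-463736)) :=
    (hasValueAt_point hnsT₃).congr rfl (by norm_num)
  have hfP₁ : E.HasValueAt (kummerFn (13 : ℚ) 14) (toGeom P₁) (ι 25272) :=
    (hasValueAt_point hnsP₁).congr rfl (by norm_num)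
  have hfP₂ : E.HasValueAt (kummerFn (13 : ℚ) 14) (toGeom P₂) (ι (-19208)) :=
    (hasValueAt_point hnsP₂).congr rfl (by norm_num)
  -- the base point `Q₀ = P₁`, `a₀ = f_T(5P₁)`
  obtain ⟨h50, h5T⟩ := five_nsmul_ne (h := hnsP₁) (by norm_num : (-78 : ℚ) ≠ 0) (by norm_num)
  obtain ⟨x₅, y₅, h₅, e₅⟩ : ∃ (x y : ℚ) (h : E.toAffine.Nonsingular x y),
      (5 : ℕ) • P₁ = Affine.Point.some x y h := by
    rcases h5 : (5 : ℕ) • P₁ with _ | ⟨x, y, h⟩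
    · exact absurd h5 h50
    · exact ⟨x, y, h, rfl⟩
  have ha₀ : E.HasValueAt (kummerFn (13 : ℚ) 14) (((5 : ℕ) : ℤ) • toGeom P₁)
      (ι (x₅ * y₅ - 14 * x₅ ^ 2 + 14 ^ 2 * y₅)) := by
    rw [natCast_zsmul, ← map_nsmul, e₅]
    exact hasValueAt_point h₅
  -- the two relations: `i T₂ + j P₁ + k P₂ = 5Q` and `T₂ + (-T₂) + 0 P₁ = 5·O`
  obtain ⟨u, hu0, hu⟩ := exists_pow_five_mul_eq hT₂0 hT₂T hP₁0 hP₁T hP₂0 hP₂T hfT₂ hfP₁ hfP₂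
    h50 h5T ha₀ i j k hrel
  have hrel' : 1 • T₂ + 1 • Affine.Point.some 182 0 hnsT₃ + 0 • P₁ = (5 : ℕ) • (0 : E.toAffine.Point) := by
    rw [one_nsmul, one_nsmul, zero_nsmul, add_zero, nsmul_zero, ← neg_T₂, add_neg_cancel]
  obtain ⟨u₁, hu₁0, hu₁⟩ := exists_pow_five_mul_eq hT₂0 hT₂T hT₃0 hT₃T hP₁0 hP₁T hfT₂ hfT₃ hfP₁
    h50 h5T ha₀ 1 1 0 hrel'
  -- eliminate `a₀`: `Φ² u₁^{5s} = u^{10} Ψ^s` in `ℚ`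
  set s := i + j + k with hs
  set a₀ := ι (x₅ * y₅ - 14 * x₅ ^ 2 + 14 ^ 2 * y₅) with ha₀def
  set Φ : ℚ := 430612 ^ i * 25272 ^ j * (-19208) ^ k with hΦ
  set Ψ : ℚ := 430612 ^ 1 * (-463736) ^ 1 * 25272 ^ 0 with hΨ
  have e1 : ι Φ ^ 2 = ι u ^ 10 * a₀ ^ (2 * s) := by rw [← hu]; ring
  have e2 : ι Ψ ^ s = ι u₁ ^ (5 * s) * a₀ ^ (2 * s) := by
    rw [← hu₁, show 1 + 1 + 0 = 2 from rfl]; ring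
  have key : ι (Φ ^ 2 * u₁ ^ (5 * s)) = ι (u ^ 10 * Ψ ^ s) := by
    rw [map_mul, map_mul, map_pow, map_pow, map_pow, map_pow, e1, e2]; ring
  have hQ : Φ ^ 2 * u₁ ^ (5 * s) = u ^ 10 * Ψ ^ s := ι.injective key
  have hΦ0 : Φ ≠ 0 := by positivity
  have hΨ0 : Ψ ≠ 0 := by norm_num [hΨ]
  -- valuations at `2`, `7`, `13`
  obtain ⟨⟨a2, b2, c2, d2⟩, ⟨a7, b7, c7, d7⟩, ⟨a13, b13, c13, d13⟩⟩ := vals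
  haveI : Fact (Nat.Prime 2) := ⟨Nat.prime_two⟩
  have h2 := five_dvd_of_rel (p := 2) hΦ0 hΨ0 hu0 hu₁0 hQ
  have h7 := @five_dvd_of_rel 7 ⟨by norm_num⟩ _ _ _ _ hΦ0 hΨ0 hu0 hu₁0 _ hQ
  have h13 := @five_dvd_of_rel 13 ⟨by norm_num⟩ _ _ _ _ hΦ0 hΨ0 hu0 hu₁0 _ hQ
  rw [hΦ, padicValRat_prod_pow 2 (by norm_num) (by norm_num) (by norm_num), a2, b2, c2, hΨ,
    @padicValRat_prod_pow 2 _ _ _ _ (by norm_num) (by norm_num) (by norm_num), a2, d2, b2] at h2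
  rw [hΦ, @padicValRat_prod_pow 7 ⟨by norm_num⟩ _ _ _ (by norm_num) (by norm_num) (by norm_num), a7, b7,
    c7, hΨ, @padicValRat_prod_pow 7 ⟨by norm_num⟩ _ _ _ (by norm_num) (by norm_num) (by norm_num), a7,
    d7, b7] at h7
  rw [hΦ, @padicValRat_prod_pow 13 ⟨by norm_num⟩ _ _ _ (by norm_num) (by norm_num) (by norm_num), a13,
    b13, c13, hΨ, @padicValRat_prod_pow 13 ⟨by norm_num⟩ _ _ _ (by norm_num) (by norm_num) (by norm_num),
    a13, d13, b13] at h13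
  push_cast at h2 h7 h13
  omega

/-- **`#E(ℚ)/5E(ℚ) ≥ 125`**: the `125` classes `i·T₂ + j·P₁ + k·P₂`, `0 ≤ i, j, k < 5`, are distinct.
[cite: SilvermanAEC2009, Thm. X.1.1 and Exercise 10.1] -/
theorem card_quotient_ge :
    125 ≤ Nat.card (E.toAffine.Point ⧸
      (nsmulAddMonoidHom (5 : ℕ) : E.toAffine.Point →+ E.toAffine.Point).range) := by
  set N := (nsmulAddMonoidHom (5 : ℕ) : E.toAffine.Point →+ E.toAffine.Point).range with hN
  -- finiteness of the quotient (Mordell–Weil)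
  have hcard := natCard_quotient_nsmulRange_eq E.toAffine.Point 5
  rw [natCard_torsionBy_five] at hcard
  haveI : Finite (E.toAffine.Point ⧸ N) := Nat.finite_of_card_ne_zero (by rw [hcard]; positivity)
  let g : Fin 5 × Fin 5 × Fin 5 → E.toAffine.Point ⧸ N :=
    fun t ↦ ((t.1.val • T₂ + t.2.1.val • P₁ + t.2.2.val • P₂ : E.toAffine.Point) : E.toAffine.Point ⧸ N)
  have hg : Function.Injective g := by
    rintro ⟨⟨i, hi⟩, ⟨j, hj⟩, ⟨k, hk⟩⟩ ⟨⟨i', hi'⟩, ⟨j', hj'⟩, ⟨k', hk'⟩⟩ h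
    simp only [g] at h
    rw [QuotientAddGroup.eq_iff_sub_mem, hN, AddMonoidHom.mem_range] at h
    obtain ⟨Y, hY⟩ := h
    rw [nsmulAddMonoidHom_apply] at hY
    -- `(i + 5 - i') T₂ + (j + 5 - j') P₁ + (k + 5 - k') P₂ = 5 (Y + T₂ + P₁ + P₂)`
    have e₁ : (5 : ℕ) • T₂ = i' • T₂ + (5 - i') • T₂ := by rw [← add_nsmul]; congr 1; omega
    have e₂ : (5 : ℕ) • P₁ = j' • P₁ + (5 - j') • P₁ := by rw [← add_nsmul]; congr 1; omega
    have e₃ : (5 : ℕ) • P₂ = k' • P₂ + (5 - k') • P₂ := by rw [← add_nsmul]; congr 1; omega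
    have hrel : (i + (5 - i')) • T₂ + (j + (5 - j')) • P₁ + (k + (5 - k')) • P₂ =
        (5 : ℕ) • (Y + T₂ + P₁ + P₂) := by
      rw [nsmul_add, nsmul_add, nsmul_add, hY, e₁, e₂, e₃, add_nsmul, add_nsmul, add_nsmul]
      abel
    obtain ⟨d₁, d₂, d₃⟩ := indep hrel
    simp only [Prod.mk.injEq, Fin.mk.injEq]
    omega
  have := Nat.card_le_card_of_injective g hg
  simpa using this

/-- **`rank E_{13/14}(ℚ) ≥ 2`.** With `#E(ℚ)/5E(ℚ) = 5^{rank} · #E(ℚ)[5]` (Mordell–Weil and the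
structure theorem, tree `natCard_quotient_nsmulRange_eq`), `#E(ℚ)[5] = 5` and `#E(ℚ)/5E(ℚ) ≥ 125`.
[cite: SilvermanAEC2009, Thm. X.1.1 and Exercise 10.1 (the method; the curve and points are ours)] -/
theorem two_le_mordellWeilRank : 2 ≤ E.mordellWeilRank := by
  have hcard := natCard_quotient_nsmulRange_eq E.toAffine.Point 5
  rw [natCard_torsionBy_five] at hcard
  have h := card_quotient_ge
  rw [hcard] at h
  have hr : E.mordellWeilRank = Module.finrank ℤ E.toAffine.Point := by
    unfold WeierstrassCurve.mordellWeilRank; congr!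
  rw [hr]
  have h25 : 5 ^ 2 ≤ 5 ^ Module.finrank ℤ E.toAffine.Point := by
    have : 25 * 5 ≤ 5 ^ Module.finrank ℤ E.toAffine.Point * 5 := by simpa using h
    exact le_of_mul_le_mul_right this (by norm_num)
  exact (Nat.pow_le_pow_iff_right (by norm_num)).mp h25

end KubertTate1314Descent

end Literature.NumberTheory.EllipticCurves

end
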